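import Literature.AlgebraicGeometry.Limits.LocalizationOpenDescent
import Mathlib.RingTheory.Ideal.GoingUp
import Mathlib.RingTheory.Localization.FractionRing
import Mathlib.Algebra.CharP.Lemmas
import HarnessLib

/-!
# Geometric points of a stage `P ⊗ D(t)` which factor through the generic base `P ⊗ Spec A_S`; characteristic-`0` points over a number ring do
# ([GortzWedhorn2020] §(4.7) (4.7.1), §(10.13); [StacksProject] Tag 00FE — «a prime of an integral extension of `ℤ` lying over `(0)` is `(0)`»)

Topic `Literature/AlgebraicGeometry/Limits`; namespace `Literature.AlgebraicGeometry.Limits.LocApprox` (the series `LocalizationDiagram` …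
`LocalizationOpenDescent`).  THEOREMS ONLY (no definition, no named fact, no instance, no notation, no `sorry`).  Cell `hodgecm-mathlib` (D-0151),
P6 «MOD programme», L4 DUALS road, plumbing for the stage Mumford-bundle package (LA4-p05 (g0); consumer: chain step (4), feeding the `hwit` of ★
`AbelianSchemes/RankOneLocalEmbeddingSpreadDedekind` from the `hgen` of ★ `AbelianSchemes/RankOneAmpleClassSpreadStage` §2).  HC_CM is proved only
modulo the printed citations until rung 0 closes; this file is general scheme theory and changes no count.

SETTING (★ `LocalizationDiagram` ∕ `LocalizationOpenDescent`): `A` a ring, `S ⊆ A` a submonoid, `B = A_S`, stages `D(t) = Spec A[1∕t]` (`t : Idx S`),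
cone legs `leg S B t : Spec B ⟶ D(t)` over `A`, `P → Spec A` any `A`-scheme, stage bases `P ⊗ D(t)` and generic base `P ⊗ Spec B`.

* §1 **`exists_eq_comp_whiskerLeft_leg_of_fac`** — a point `z : Spec Ω → (P ⊗ D(t)).left` (`Ω` ANY ring) whose second component `Spec Ω → D(t)`
  factors through `leg S B t` on the ring side (`χ : B → Ω` with `χ ∘ (A[1∕t] → B) = ψ_z`) factors through the generic base:
  `z = y ≫ (P ◁ leg S B t)` for some `y : Spec Ω → (P ⊗ Spec B).left` (`P ⊗ T = P ×_A T`, Mathlib `Over.tensorObj_left`, `pullback.lift`).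
* §2 **`exists_eq_comp_whiskerLeft_leg_of_injective`** — `A` a domain, `K` its fraction field (`S ≤ A ∖ 0`): if the ring map `A → Ω` induced by
  `z` is INJECTIVE then `z` factors through `P ⊗ Spec K` (Mathlib `IsFractionRing.lift`, `IsLocalization.ringHom_ext` on `A[1∕t]`).
* §3 **`injective_of_charZero_of_forall_prime`**, **`exists_eq_comp_whiskerLeft_leg_of_charZero`** — if every NON-ZERO prime of `A` contains a
  non-zero natural number (e.g. `A` integral over `ℤ`: `exists_nat_mem_of_isIntegral_int`, Mathlib `Ideal.eq_bot_of_comap_eq_bot`), then for a field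
  `Ω` of CHARACTERISTIC `0` every point `Spec Ω → (P ⊗ D(t)).left` factors through the generic base (its kernel is a prime containing no `n ≠ 0`).
  For `A = 𝓞_F`: the characteristic-`0` geometric points of a stage base lie over the generic fibre.

## References
* [GortzWedhorn2020] U. Görtz, T. Wedhorn, *Algebraic Geometry I*, 2nd ed. (2020), §(4.7) (4.7.1) (p. 108), §(10.13) (pp. 261–262).
* [StacksProject] The Stacks Project, Tags 00FE, 00GQ (lying over ∕ incomparability for integral extensions).
* [AtiyahMacdonald1969] M. F. Atiyah, I. G. Macdonald, *Introduction to Commutative Algebra* (1969), Cor. 5.9 (p. 61), Prop. 3.1 (p. 37).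
-/

set_option autoImplicit false

noncomputable section

-- `(P ⊗ T).left = pullback P.hom T.hom` (`Over.tensorObj_left`) and `((baseDiagram S).obj t).left = Spec A[1∕t]` are `rfl` only at default
-- transparency (as in ★ `PolarizationSpreadStageAmpleLocus`).
set_option backward.isDefEq.respectTransparency false

universe u

open CategoryTheory CategoryTheory.Limits AlgebraicGeometry MonoidalCategory Opposite

namespace Literature.AlgebraicGeometry.Limits

namespace LocApprox

open Literature.AlgebraicGeometry.Motives (SchemeOver specOver)

variable {A : Type u} [CommRing A] {S : Submonoid A} (B : Type u) [CommRing B] [Algebra A B] [IsLocalization S B]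
  (P : SchemeOver A) {t : Idx S}

/-! ## §1 Factorisation through the generic base from a ring-side factorisation of the second component -/

/-- **A point of the stage base whose second component factors through the cone leg factors through the generic base.**  For
`z : Spec Ω → (P ⊗ D(t)).left` (`Ω` any ring) write `z ≫ pr₂ = Spec ψ` with `ψ : A[1∕t] → Ω`; if `ψ = χ ∘ (A[1∕t] → B)` for some `χ : B → Ω`, then
`z = y ≫ (P ◁ leg_t).left` with `y := (z ≫ pr₁, Spec χ) : Spec Ω → P ×_A Spec B`.  (`P ⊗ T = P ×_{Spec A} T`, Mathlib `Over.tensorObj_left`;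
the two components of `P ◁ leg_t` are `pr₁` and `pr₂ ≫ leg_t`, Mathlib `Over.whiskerLeft_left_fst∕snd`.) [cite: GortzWedhorn2020, §(4.7) (4.7.1) (p. 108)] -/
theorem exists_eq_comp_whiskerLeft_leg_of_fac {Ω : Type u} [CommRing Ω] (z : Spec (.of Ω) ⟶ (P ⊗ (baseDiagram S).obj t).left)
    (ψ : loc S t →+* Ω) (hψ : z ≫ pullback.snd P.hom ((baseDiagram S).obj t).hom = Spec.map (CommRingCat.ofHom ψ))
    (χ : B →+* Ω) (hχ : χ.comp (toLoc S B t) = ψ) :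
    ∃ y : Spec (.of Ω) ⟶ (P ⊗ specOver A B).left, y ≫ (P ◁ leg S B t).left = z := by
  -- the second component through `Spec B`
  have hleg : (leg S B t).left = Spec.map (CommRingCat.ofHom (toLoc S B t)) := baseCone_π_app_left' S B t
  have h2 : Spec.map (CommRingCat.ofHom χ) ≫ (leg S B t).left = z ≫ pullback.snd P.hom ((baseDiagram S).obj t).hom := by
    rw [hψ, hleg]
    change Spec.map (CommRingCat.ofHom χ) ≫ Spec.map (CommRingCat.ofHom (toLoc S B t)) = Spec.map (CommRingCat.ofHom ψ)
    rw [← Spec.map_comp, ← CommRingCat.ofHom_comp, hχ]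
  -- compatibility over `Spec A`: `(z ≫ pr₁) ≫ P.hom = Spec χ ≫ (Spec B → Spec A)`
  have hw : (z ≫ pullback.fst P.hom ((baseDiagram S).obj t).hom) ≫ P.hom =
      Spec.map (CommRingCat.ofHom χ) ≫ (specOver A B).hom := by
    have hc : pullback.fst P.hom ((baseDiagram S).obj t).hom ≫ P.hom =
        pullback.snd P.hom ((baseDiagram S).obj t).hom ≫ ((baseDiagram S).obj t).hom := pullback.condition
    calc (z ≫ pullback.fst P.hom ((baseDiagram S).obj t).hom) ≫ P.hom
        = z ≫ (pullback.snd P.hom ((baseDiagram S).obj t).hom ≫ ((baseDiagram S).obj t).hom) := by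
          rw [Category.assoc, hc]
      _ = (Spec.map (CommRingCat.ofHom χ) ≫ (leg S B t).left) ≫ ((baseDiagram S).obj t).hom := by
          rw [← Category.assoc, h2]
      _ = Spec.map (CommRingCat.ofHom χ) ≫ (specOver A B).hom := by
          rw [Category.assoc, Over.w (leg S B t)]
  refine ⟨pullback.lift (z ≫ pullback.fst P.hom ((baseDiagram S).obj t).hom) (Spec.map (CommRingCat.ofHom χ)) hw, ?_⟩
  apply pullback.hom_ext
  · have e1 : (P ◁ leg S B t).left ≫ pullback.fst P.hom ((baseDiagram S).obj t).hom = pullback.fst P.hom (specOver A B).hom :=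
      Over.whiskerLeft_left_fst (leg S B t)
    rw [Category.assoc, e1, pullback.lift_fst]
  · have e2 : (P ◁ leg S B t).left ≫ pullback.snd P.hom ((baseDiagram S).obj t).hom =
        pullback.snd P.hom (specOver A B).hom ≫ (leg S B t).left := Over.whiskerLeft_left_snd (leg S B t)
    rw [Category.assoc, e2, pullback.lift_snd_assoc, h2]

/-! ## §2 Over a domain: points whose ring map `A → Ω` is injective factor through `P ⊗ Spec (Frac A)` -/

section Domain

variable {A : Type u} [CommRing A] {S : Submonoid A} (K : Type u) [Field K] [Algebra A K] [IsFractionRing A K]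
  [IsLocalization S K] (P : SchemeOver A) {t : Idx S}

/-- **Injective `A → Ω` ⇒ the point factors through the generic base `P ⊗ Spec K`** (`K = Frac A`): the ring map `ψ : A[1∕t] → Ω` of the second
component restricts to an injective `A → Ω`, hence extends to `χ : K → Ω` (Mathlib `IsFractionRing.lift`) with `χ ∘ (A[1∕t] → K) = ψ` (both agree on
`A`; Mathlib `IsLocalization.ringHom_ext`); then §1. [cite: GortzWedhorn2020, §(4.7) (4.7.1) (p. 108)] [cite: AtiyahMacdonald1969, Prop. 3.1 (p. 37)] -/
theorem exists_eq_comp_whiskerLeft_leg_of_injective {Ω : Type u} [Field Ω] (z : Spec (.of Ω) ⟶ (P ⊗ (baseDiagram S).obj t).left)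
    (ψ : loc S t →+* Ω) (hψ : z ≫ pullback.snd P.hom ((baseDiagram S).obj t).hom = Spec.map (CommRingCat.ofHom ψ))
    (hinj : Function.Injective (ψ.comp (algebraMap A (loc S t)))) :
    ∃ y : Spec (.of Ω) ⟶ (P ⊗ specOver A K).left, y ≫ (P ◁ leg S K t).left = z := by
  letI : Algebra A Ω := (ψ.comp (algebraMap A (loc S t))).toAlgebra
  let χ : K →+* Ω := IsFractionRing.lift (K := K) (g := ψ.comp (algebraMap A (loc S t))) hinj
  refine exists_eq_comp_whiskerLeft_leg_of_fac K P z ψ hψ χ ?_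
  refine IsLocalization.ringHom_ext (Submonoid.powers t.val) (S := loc S t) ?_
  rw [RingHom.comp_assoc, toLoc_comp_algebraMap]
  ext a
  rw [RingHom.comp_apply]
  exact IsFractionRing.lift_algebraMap (K := K) hinj a

/-! ## §3 Characteristic-`0` points over a ring whose non-zero primes have positive residue characteristic -/

/-- **A ring map from `A` to a ring of characteristic `0` is injective** as soon as every non-zero prime of the domain `A` contains a non-zero natural
number (its kernel is a prime containing no `n ≠ 0`). [cite: StacksProject, Tag 00FE] -/
theorem injective_of_charZero_of_forall_prime [IsDomain A] (hA : ∀ (𝔭 : Ideal A), 𝔭.IsPrime → 𝔭 ≠ ⊥ → ∃ n : ℕ, n ≠ 0 ∧ (n : A) ∈ 𝔭)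
    {Ω : Type u} [CommRing Ω] [IsDomain Ω] [CharZero Ω] (φ : A →+* Ω) : Function.Injective φ := by
  rw [RingHom.injective_iff_ker_eq_bot]
  by_contra hne
  obtain ⟨n, hn0, hn⟩ := hA (RingHom.ker φ) (RingHom.ker_isPrime φ) hne
  rw [RingHom.mem_ker, map_natCast] at hn
  exact hn0 (Nat.cast_eq_zero.mp hn)

/-- For `A` INTEGRAL over `ℤ` (e.g. a ring of integers `𝓞_F`, an order) every non-zero prime contains a non-zero natural number: its contraction to
`ℤ` is non-zero (Mathlib `Ideal.eq_bot_of_comap_eq_bot`), and with `m` it contains `|m|`. [cite: StacksProject, Tag 00GQ] [cite: AtiyahMacdonald1969, Cor. 5.9 (p. 61)] -/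
theorem exists_nat_mem_of_isIntegral_int [IsDomain A] [Algebra.IsIntegral ℤ A] (𝔭 : Ideal A) [𝔭.IsPrime] (h𝔭 : 𝔭 ≠ ⊥) :
    ∃ n : ℕ, n ≠ 0 ∧ (n : A) ∈ 𝔭 := by
  have hc : 𝔭.comap (algebraMap ℤ A) ≠ ⊥ := fun h => h𝔭 (Ideal.eq_bot_of_comap_eq_bot h)
  obtain ⟨m, hm, hm0⟩ := Submodule.exists_mem_ne_zero_of_ne_bot hc
  refine ⟨m.natAbs, Int.natAbs_ne_zero.mpr hm0, ?_⟩
  rw [Ideal.mem_comap, eq_intCast] at hm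
  have key : ((m.natAbs : ℤ) : A) ∈ 𝔭 := by
    rcases Int.natAbs_eq m with h | h
    · rw [← h]; exact hm
    · rw [h, Int.cast_neg] at hm
      exact (Ideal.neg_mem_iff (I := 𝔭)).mp hm
  rwa [Int.cast_natCast] at key

/-- **A CHARACTERISTIC-`0` field point of a stage base factors through the generic base** when every non-zero prime of the domain `A` contains a non-zero
natural number (`A = 𝓞_F`: the characteristic-`0` geometric points of `P ⊗ D(t)` lie over the generic fibre, so the stage data read there are GENERIC
data).  §2 with injectivity from `injective_of_charZero_of_forall_prime`. [cite: GortzWedhorn2020, §(10.13) (pp. 261–262)] [cite: StacksProject, Tag 00FE] -/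
theorem exists_eq_comp_whiskerLeft_leg_of_charZero [IsDomain A] (hA : ∀ (𝔭 : Ideal A), 𝔭.IsPrime → 𝔭 ≠ ⊥ → ∃ n : ℕ, n ≠ 0 ∧ (n : A) ∈ 𝔭)
    {Ω : Type u} [Field Ω] [CharZero Ω] (z : Spec (.of Ω) ⟶ (P ⊗ (baseDiagram S).obj t).left) :
    ∃ y : Spec (.of Ω) ⟶ (P ⊗ specOver A K).left, y ≫ (P ◁ leg S K t).left = z := by
  obtain ⟨ψ', hψ'⟩ := Spec.map_surjective (z ≫ pullback.snd P.hom ((baseDiagram S).obj t).hom)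
  refine exists_eq_comp_whiskerLeft_leg_of_injective K P z ψ'.hom ?_ (injective_of_charZero_of_forall_prime hA _)
  rw [CommRingCat.ofHom_hom]
  exact hψ'.symm

/-- The same for `A` integral over `ℤ` (rings of integers of number fields, orders). [cite: StacksProject, Tag 00GQ] [cite: GortzWedhorn2020, §(10.13) (pp. 261–262)] -/
theorem exists_eq_comp_whiskerLeft_leg_of_charZero_of_isIntegral_int [IsDomain A] [Algebra.IsIntegral ℤ A]
    {Ω : Type u} [Field Ω] [CharZero Ω] (z : Spec (.of Ω) ⟶ (P ⊗ (baseDiagram S).obj t).left) :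
    ∃ y : Spec (.of Ω) ⟶ (P ⊗ specOver A K).left, y ≫ (P ◁ leg S K t).left = z :=
  exists_eq_comp_whiskerLeft_leg_of_charZero K P (fun 𝔭 h𝔭 hne => by
    haveI := h𝔭
    exact exists_nat_mem_of_isIntegral_int 𝔭 hne) z

end Domain

end LocApprox

end Literature.AlgebraicGeometry.Limits

end
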